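import Summits.Ventures.HodgeKum4.Theorems.KummerFixedLocusHasFixedPointTangent
import Summits.Ventures.HodgeKum4.Theorems.KummerFixedLocusRankTwoFixedSpace
import Mathlib.GroupTheory.Index
import Mathlib.Data.ZMod.QuotientGroup
import HarnessLib

/-!
# (H2) from print: `Γ(K⁴(A))` is TRANSITIVE on the fixed points of each `g ∈ Γ ∖ 1`, by the tangent-dimension
# argument (cell `hodge-kum4`, seat p2; items stmt-Ventures-19595 / 19504)

HONEST FRAMING.  Nothing here is proved outright about `K⁴(A)` or the Hodge conjecture: the theorems are
CONDITIONAL on three printed statements taken as hypotheses — `Γ ≅ (ℤ/5)⁴` (Floccari–Varesco, REFEREED),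
"`K^{⟨g⟩} = 125` reduced points" (Oguiso 2020 Prop. 3.5–3.6, REFEREED) and the tangent-dimension form of the
smoothness of fixed loci (Milne *Algebraic Groups* Thm. 13.1 / Conrad–Gabber–Prasad A.8.10 / Görtz–Wedhorn
Thm. 6.28, REFEREED textbook; `GroupActions.Milne2017_fixedComponent_dim_eq_finrank_tangentFixed`).  From
these the file DERIVES the transitivity statement (H2)
`Hyperkaehler.Oguiso2020_translations_transitive_fixedPoints_generalizedKummerFour` (so far a
print-SYNTHESIS input of the rung, Oguiso's Prop. 3.6 PROOF + one torsor step), and hence re-cuts the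
Route-A closers of (H3), of the point count and of `HC_Kum4Type` WITHOUT (H2).

## The argument

`Γ = Γ(K) ≅ (ℤ/5)⁴` acts on the finite set `S = Fix(g)(ℂ)` (`Γ` is commutative), `|S| = 125`, `|Γ| = 625`.
For `x ∈ S` the stabiliser `Γ_x ⊇ ⟨g⟩`; CLAIM `Γ_x = ⟨g⟩`, whence `|Γ·x| = 625/5 = 125 = |S|`, i.e. `Γ` is
transitive on `S`.  Proof of the claim: if `γ ∈ Γ_x ∖ ⟨g⟩`, every `δ = gⁱγʲ ≠ 1` (`(i,j) ≠ (0,0)`) lies in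
`Γ ∖ 1` and fixes `x`, so `Fix(δ)` is `125` reduced points (Oguiso) and the tangent-dimension fact at the
POINT-component through `x` gives `(T_x K)^δ = 0`; but the commuting operators `dg, dγ` of order `5` on
`T_x K ≅ ℂ⁸ ≠ 0` cannot have all `dgⁱ dγʲ ≠ 1` fixed-point free
(`RankTwo.eq_zero_of_free`, `Theorems/KummerFixedLocusRankTwoFixedSpace`: no free linear action of `(ℤ/5)²`).  ∎
-/

noncomputable section

open CategoryTheory CategoryTheory.Limits MonoidalCategory CartesianMonoidalCategory
open AlgebraicGeometry
open Literature.AlgebraicGeometry Literature.AlgebraicGeometry.Motives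
open Literature.AlgebraicGeometry.Hyperkaehler Literature.AlgebraicGeometry.GroupActions

namespace Summit.Ventures.HodgeKum4

/-- `γ⁵ = 1` and `γʲ ∈ H` for some `0 < j < 5` imply `γ ∈ H`. -/
theorem mem_of_pow_mem_of_pow_five {G : Type*} [Group G] (H : Subgroup G) {γ : G} (h5 : γ ^ 5 = 1)
    {j : ℕ} (hj0 : 0 < j) (hj5 : j < 5) (hmem : γ ^ j ∈ H) : γ ∈ H := by
  have h6 : γ ^ 6 = γ := by rw [pow_succ, h5, one_mul]
  have h16 : γ ^ 16 = γ := by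
    rw [show (16 : ℕ) = 5 * 3 + 1 by norm_num, pow_add, pow_mul, h5, one_pow, one_mul, pow_one]
  interval_cases j
  · simpa using hmem
  · have := H.pow_mem hmem 3
    rwa [← pow_mul, show 2 * 3 = 6 by norm_num, h6] at this
  · have := H.pow_mem hmem 2
    rwa [← pow_mul, show 3 * 2 = 6 by norm_num, h6] at this
  · have := H.pow_mem hmem 4
    rwa [← pow_mul, show 4 * 4 = 16 by norm_num, h16] at this

/-- **(H2) from print — transitivity of `Γ(K⁴(A))` on the fixed points of each `g ∈ Γ ∖ 1`**, derived
from `Γ ≅ (ℤ/5)⁴` (Floccari–Varesco), Oguiso's `125` reduced fixed points and the tangent-dimension fact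
(module docstring).  CONDITIONAL on the three printed statements; the conclusion is the Literature statement
`Oguiso2020_translations_transitive_fixedPoints_generalizedKummerFour` BY NAME. -/
theorem oguiso2020_translations_transitive_of_tangentFixed
    (hFV : FloccariVaresco2024_autFixingH2H3_equiv_kumType)
    (hOg : Oguiso2020_fixedPointScheme_translation_generalizedKummerFour)
    (hT : GroupActions.Milne2017_fixedComponent_dim_eq_finrank_tangentFixed) :
    Oguiso2020_translations_transitive_fixedPoints_generalizedKummerFour := by
  intro A K hA hKum hK8 g hg x y hx hy
  classical
  -- `K` is of `Kum⁴`-type, proper; `Γ(K) ≅ (ℤ/5)⁴`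
  obtain ⟨M⟩ := HodgeTheory.nonempty_hodgeModel_holds (n := 8) (X := K) hK8
  have hKK : IsOfGeneralizedKummerType 4 K :=
    IsOfGeneralizedKummerType.of_hodgeModel (n := 4) hA hKum hK8 M
  haveI : IsProper K.hom := hK8.isProjectiveOver.isProper
  obtain ⟨e⟩ := hFV 4 (by norm_num) hK8 hKK
  have hcomm : ∀ p q : Hyperkaehler.autFixingH2H3 K, p * q = q * p := fun p q =>
    e.injective ((e.map_mul p q).trans ((mul_comm _ _).trans (e.map_mul q p).symm))
  have hcard : Nat.card (Hyperkaehler.autFixingH2H3 K) = 625 :=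
    FloccariVaresco2024_autFixingH2H3_equiv_kumType.floccari2026_card hFV hK8 hKK
  have hpow5 : ∀ γ : Hyperkaehler.autFixingH2H3 K, γ ^ 5 = 1 := by
    intro γ
    apply e.injective
    have hz : ∀ z : Multiplicative (Fin 4 → ZMod (4 + 1)), z ^ 5 = 1 := by
      intro z
      apply Multiplicative.toAdd.injective
      rw [toAdd_pow, toAdd_one]
      funext i
      simp only [Pi.smul_apply, Pi.zero_apply, nsmul_eq_mul]
      have h5 : ((5 : ℕ) : ZMod (4 + 1)) = 0 := by decide
      rw [h5, zero_mul]
    calc e (γ ^ 5) = e γ ^ 5 := map_pow e γ 5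
      _ = 1 := hz _
      _ = e 1 := (map_one e).symm
  haveI : Fact (Nat.Prime 5) := ⟨by norm_num⟩
  have horder : orderOf g = 5 := orderOf_eq_prime (hpow5 g) hg
  haveI : Finite (Hyperkaehler.autFixingH2H3 K) := Nat.finite_of_card_ne_zero (by rw [hcard]; norm_num)
  -- the finite `Γ`-set `S` of `g`-fixed sections
  let S := {s : 𝟙_ (Motives.SchemeOver ℂ) ⟶ K // s ≫ g.val.hom = s}
  have hact_mem : ∀ (γ : Hyperkaehler.autFixingH2H3 K) (s : S),
      (s.val ≫ γ.val.hom) ≫ g.val.hom = s.val ≫ γ.val.hom := by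
    intro γ s
    have hγg : γ.val.hom ≫ g.val.hom = g.val.hom ≫ γ.val.hom := by
      have := congrArg (fun δ : Hyperkaehler.autFixingH2H3 K => δ.val.hom) (hcomm g γ)
      simpa [Subgroup.coe_mul, Aut.Aut_mul_def] using this
    rw [Category.assoc, hγg, ← Category.assoc, s.property]
  letI : SMul (Hyperkaehler.autFixingH2H3 K) S := ⟨fun γ s => ⟨s.val ≫ γ.val.hom, hact_mem γ s⟩⟩
  letI : MulAction (Hyperkaehler.autFixingH2H3 K) S :=
    { one_smul := fun s => Subtype.ext (Category.comp_id s.val)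
      mul_smul := fun p q s => Subtype.ext
        ((Category.assoc s.val q.val.hom p.val.hom).symm :
          s.val ≫ (p * q).val.hom = (s.val ≫ q.val.hom) ≫ p.val.hom) }
  have hsmul : ∀ (γ : Hyperkaehler.autFixingH2H3 K) (s : S), (γ • s).val = s.val ≫ γ.val.hom := fun _ _ => rfl
  -- `|S| = 125` (Oguiso's split fixed-point scheme of `⟨g⟩`)
  haveI : Finite (Subgroup.zpowers g.val) := by
    have hle : Subgroup.zpowers g.val ≤ Hyperkaehler.autFixingH2H3 K := (Subgroup.zpowers_le).2 g.2
    exact Set.Finite.subset (Set.toFinite (Hyperkaehler.autFixingH2H3 K : Set (Aut K))) hle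
  obtain ⟨F, j, hj⟩ := exists_isFixedPointScheme (Subgroup.zpowers g.val).subtype
  obtain ⟨xs, ⟨hxs⟩⟩ := hOg hA hKum hK8 g hg j hj
  have hjg : j ≫ g.val.hom = j := hj.comp_hom ⟨g.val, Subgroup.mem_zpowers g.val⟩
  haveI : Mono j := hj.toIsFixedPointObject.mono
  let enum : Fin 125 → S := fun k => ⟨xs k ≫ j, by rw [Category.assoc, hjg]⟩
  have henum : Function.Bijective enum := by
    constructor
    · intro k k' hkk'
      have h1 : xs k ≫ j = xs k' ≫ j := congrArg Subtype.val hkk'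
      exact SplitPoints.injective xs hxs ((cancel_mono j).1 h1)
    · intro s
      have hs' : ∀ a : Subgroup.zpowers g.val,
          s.val ≫ ((Subgroup.zpowers g.val).subtype a).hom = s.val :=
        fun a => comp_hom_eq_of_mem_zpowers g.val s.val s.property a.val a.property
      obtain ⟨t, ht, -⟩ := hj.existsUnique_fac s.val hs'
      obtain ⟨k, rfl⟩ := SplitPoints.exists_eq xs hxs t
      exact ⟨k, Subtype.ext ht⟩
  have hcardS : Nat.card S = 125 := by
    rw [← Nat.card_congr (Equiv.ofBijective enum henum), Nat.card_fin]
  haveI : Finite S := Finite.of_equiv _ (Equiv.ofBijective enum henum)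
  -- the two points as elements of `S`
  let x' : S := ⟨x, hx⟩
  let y' : S := ⟨y, hy⟩
  -- CLAIM: the stabiliser of `x'` is `⟨g⟩`
  have hstab : MulAction.stabilizer (Hyperkaehler.autFixingH2H3 K) x' = Subgroup.zpowers g := by
    apply le_antisymm
    · intro γ hγ
      rw [MulAction.mem_stabilizer_iff] at hγ
      have hγx : x ≫ γ.val.hom = x := congrArg Subtype.val hγ
      by_contra hγg
      -- the complex point `P = x`, the tangent representation of its stabiliser
      let P : Motives.ComplexPoints K := toUnit (Motives.specOver ℂ ℂ) ≫ x
      have hmemP : ∀ δ : Hyperkaehler.autFixingH2H3 K, x ≫ δ.val.hom = x →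
          δ.val ∈ GroupActions.pointStabilizer K P := by
        intro δ hδ
        rw [GroupActions.mem_pointStabilizer_iff, Motives.AlgPoints.map_apply]
        show (toUnit (Motives.specOver ℂ ℂ) ≫ x) ≫ δ.val.hom = toUnit (Motives.specOver ℂ ℂ) ≫ x
        rw [Category.assoc, hδ]
      obtain ⟨V, _, _, _, τ, hVn, hτ⟩ := hT hK8 P
      -- every `δ ∈ Γ ∖ 1` fixing `x` has no non-zero fixed tangent vector
      have hfix0 : ∀ (δ : Hyperkaehler.autFixingH2H3 K) (hδ1 : δ ≠ 1) (hδx : x ≫ δ.val.hom = x) (v : V),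
          τ ⟨δ.val, hmemP δ hδx⟩ v = v → v = 0 := by
        intro δ hδ1 hδx v hv
        let φ : GroupActions.pointStabilizer K P := ⟨δ.val, hmemP δ hδx⟩
        -- `φ` has finite order
        have hφ5 : φ ^ 5 = 1 := by
          apply Subtype.ext
          rw [Subgroup.coe_pow, Subgroup.coe_one]
          show δ.val ^ 5 = 1
          rw [← Subgroup.coe_pow, hpow5 δ, Subgroup.coe_one]
        have hφfin : IsOfFinOrder φ := isOfFinOrder_iff_pow_eq_one.2 ⟨5, by norm_num, hφ5⟩
        -- Oguiso's split of `Fix(δ)` into `125` points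
        haveI : Finite (Subgroup.zpowers δ.val) := by
          have hle : Subgroup.zpowers δ.val ≤ Hyperkaehler.autFixingH2H3 K := (Subgroup.zpowers_le).2 δ.2
          exact Set.Finite.subset (Set.toFinite (Hyperkaehler.autFixingH2H3 K : Set (Aut K))) hle
        obtain ⟨Fδ, jδ, hjδ⟩ := exists_isFixedPointScheme (Subgroup.zpowers δ.val).subtype
        obtain ⟨xδ, ⟨hxδ⟩⟩ := hOg hA hKum hK8 δ hδ1 jδ hjδ
        have hjδg : jδ ≫ δ.val.hom = jδ := hjδ.comp_hom ⟨δ.val, Subgroup.mem_zpowers δ.val⟩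
        haveI : Mono jδ := hjδ.toIsFixedPointObject.mono
        have hfixδ : {Q : Motives.ComplexPoints K |
              Motives.AlgPoints.mapContinuous (L := ℂ) φ.val.hom Q = Q} =
            ⋃ k, Set.range (Motives.AlgPoints.mapContinuous (L := ℂ) (xδ k ≫ jδ)) := by
          ext Q
          simp only [Set.mem_setOf_eq, Motives.AlgPoints.mapContinuous_apply,
            Motives.AlgPoints.map_apply, Set.mem_iUnion, range_mapContinuous_of_unit,
            Set.mem_singleton_iff]
          constructor
          · intro hQ
            have hQ' : ∀ a : Subgroup.zpowers δ.val,
                (Motives.toSpecOver (𝟙_ (Motives.SchemeOver ℂ)) ≫ Q) ≫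
                    ((Subgroup.zpowers δ.val).subtype a).hom =
                  Motives.toSpecOver (𝟙_ (Motives.SchemeOver ℂ)) ≫ Q := fun a => by
              show (Motives.toSpecOver (𝟙_ (Motives.SchemeOver ℂ)) ≫ Q) ≫ a.val.hom =
                Motives.toSpecOver (𝟙_ (Motives.SchemeOver ℂ)) ≫ Q
              rw [Category.assoc, comp_hom_eq_of_mem_zpowers δ.val Q hQ a.val a.property]
            obtain ⟨t, ht, -⟩ :=
              hjδ.existsUnique_fac (Motives.toSpecOver (𝟙_ (Motives.SchemeOver ℂ)) ≫ Q) hQ'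
            obtain ⟨k, rfl⟩ := SplitPoints.exists_eq xδ hxδ t
            refine ⟨k, ?_⟩
            rw [← toUnit_comp_toSpecOver_comp Q, ← ht]
          · rintro ⟨k, rfl⟩
            show (toUnit (Motives.specOver ℂ ℂ) ≫ xδ k ≫ jδ) ≫ δ.val.hom =
              toUnit (Motives.specOver ℂ ℂ) ≫ xδ k ≫ jδ
            rw [Category.assoc, Category.assoc, hjδg]
        have hdisjδ : ∀ k k' : Fin 125, k ≠ k' →
            Disjoint (Set.range (Motives.AlgPoints.mapContinuous (L := ℂ) (xδ k ≫ jδ)))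
              (Set.range (Motives.AlgPoints.mapContinuous (L := ℂ) (xδ k' ≫ jδ))) := by
          intro k k' hkk'
          rw [range_mapContinuous_of_unit, range_mapContinuous_of_unit, Set.disjoint_singleton]
          intro h
          apply hkk'
          have h1 : xδ k ≫ jδ = xδ k' ≫ jδ := toUnit_comp_injective h
          exact SplitPoints.injective xδ hxδ ((cancel_mono jδ).1 h1)
        obtain ⟨k₀, hk₀⟩ : ∃ k,
            P ∈ Set.range (Motives.AlgPoints.mapContinuous (L := ℂ) (xδ k ≫ jδ)) := by
          have : P ∈ {Q : Motives.ComplexPoints K |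
              Motives.AlgPoints.mapContinuous (L := ℂ) φ.val.hom Q = Q} := by
            show Motives.AlgPoints.mapContinuous (L := ℂ) δ.val.hom
                (toUnit (Motives.specOver ℂ ℂ) ≫ x) = toUnit (Motives.specOver ℂ ℂ) ≫ x
            rw [Motives.AlgPoints.mapContinuous_apply, Motives.AlgPoints.map_apply, Category.assoc,
              hδx]
          rw [hfixδ, Set.mem_iUnion] at this
          exact this
        have h0 : 0 = Module.finrank ℂ (LinearMap.ker (τ φ - 1)) :=
          hτ φ hφfin (Fin 125) inferInstance (fun _ => 𝟙_ (Motives.SchemeOver ℂ)) (fun _ => 0)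
            (fun k => xδ k ≫ jδ) (fun _ => Motives.isSmoothProjective_unit_holds ℂ)
            (fun k => isClosedImmersion_left_of_unit (xδ k ≫ jδ)) hdisjδ hfixδ k₀ hk₀
        have hbot : LinearMap.ker (τ φ - 1) = ⊥ := Submodule.finrank_eq_zero.1 h0.symm
        have hv' : v ∈ LinearMap.ker (τ φ - 1) := by
          rw [LinearMap.mem_ker, LinearMap.sub_apply, Module.End.one_apply, hv, sub_self]
        rw [hbot] at hv'
        exact (Submodule.mem_bot ℂ).1 hv'
      -- the two commuting operators `a = dg`, `b = dγ` on `T_x K`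
      let g' : GroupActions.pointStabilizer K P := ⟨g.val, hmemP g hx⟩
      let γ' : GroupActions.pointStabilizer K P := ⟨γ.val, hmemP γ hγx⟩
      have hval5 : ∀ δ : Hyperkaehler.autFixingH2H3 K, δ.val ^ 5 = 1 := fun δ => by
        rw [← Subgroup.coe_pow, hpow5 δ, Subgroup.coe_one]
      have hg'5 : g' ^ 5 = 1 := Subtype.ext (by rw [Subgroup.coe_pow, Subgroup.coe_one]; exact hval5 g)
      have hγ'5 : γ' ^ 5 = 1 := Subtype.ext (by rw [Subgroup.coe_pow, Subgroup.coe_one]; exact hval5 γ)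
      have hg'γ' : g' * γ' = γ' * g' := by
        apply Subtype.ext
        rw [Subgroup.coe_mul, Subgroup.coe_mul]
        show g.val * γ.val = γ.val * g.val
        rw [← Subgroup.coe_mul, ← Subgroup.coe_mul, hcomm g γ]
      have hcommτ : Commute (τ g') (τ γ') := by
        show τ g' * τ γ' = τ γ' * τ g'
        rw [← map_mul, ← map_mul, hg'γ']
      have ha5 : τ g' ^ 5 = 1 := by rw [← map_pow, hg'5, map_one]
      have hb5 : τ γ' ^ 5 = 1 := by rw [← map_pow, hγ'5, map_one]
      -- every `gⁱ γʲ ≠ 1` fixes `x` and is fixed-point free on `T_x K`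
      have hg_stab : g ∈ MulAction.stabilizer (Hyperkaehler.autFixingH2H3 K) x' :=
        MulAction.mem_stabilizer_iff.2 (Subtype.ext hx)
      have hγ_stab : γ ∈ MulAction.stabilizer (Hyperkaehler.autFixingH2H3 K) x' :=
        MulAction.mem_stabilizer_iff.2 hγ
      have hfree : ∀ i j : ℕ, i < 5 → j < 5 → ¬ (i = 0 ∧ j = 0) →
          ∀ v, (τ g' ^ i * τ γ' ^ j) v = v → v = 0 := by
        intro i j hi hj hij v hv
        have hδx : x ≫ (g ^ i * γ ^ j).val.hom = x := by
          have hmem : g ^ i * γ ^ j ∈ MulAction.stabilizer (Hyperkaehler.autFixingH2H3 K) x' :=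
            Subgroup.mul_mem _ (Subgroup.pow_mem _ hg_stab i) (Subgroup.pow_mem _ hγ_stab j)
          exact congrArg Subtype.val (MulAction.mem_stabilizer_iff.1 hmem)
        have hδ1 : g ^ i * γ ^ j ≠ 1 := by
          intro hδ
          -- `γʲ = g⁻ⁱ ∈ ⟨g⟩`
          have hγj : γ ^ j ∈ Subgroup.zpowers g := by
            rw [eq_inv_of_mul_eq_one_right hδ]
            exact Subgroup.inv_mem _ (Subgroup.pow_mem _ (Subgroup.mem_zpowers g) i)
          rcases Nat.eq_zero_or_pos j with hj0 | hj0
          · -- `j = 0`: `gⁱ = 1` with `0 < i < 5`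
            subst hj0
            have hi0 : i ≠ 0 := fun h => hij ⟨h, rfl⟩
            have hgi : g ^ i = 1 := by simpa using hδ
            have hdvd : orderOf g ∣ i := orderOf_dvd_of_pow_eq_one hgi
            rw [horder] at hdvd
            exact absurd (Nat.le_of_dvd (Nat.pos_of_ne_zero hi0) hdvd) (by omega)
          · exact hγg (mem_of_pow_mem_of_pow_five (Subgroup.zpowers g) (hpow5 γ) hj0 hj hγj)
        -- `τ(gⁱγʲ) = (τ g')ⁱ (τ γ')ʲ`
        have hδ' : (⟨(g ^ i * γ ^ j).val, hmemP _ hδx⟩ : GroupActions.pointStabilizer K P) =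
            g' ^ i * γ' ^ j := by
          apply Subtype.ext
          show (g ^ i * γ ^ j).val = ((g' ^ i * γ' ^ j : GroupActions.pointStabilizer K P) : Aut K)
          rw [Subgroup.coe_mul, Subgroup.coe_pow, Subgroup.coe_pow, Subgroup.coe_mul, Subgroup.coe_pow,
            Subgroup.coe_pow]
        have hτδ : τ ⟨(g ^ i * γ ^ j).val, hmemP _ hδx⟩ = τ g' ^ i * τ γ' ^ j := by
          rw [hδ', map_mul, map_pow, map_pow]
        exact hfix0 (g ^ i * γ ^ j) hδ1 hδx v (by rw [hτδ]; exact hv)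
      -- contradiction: `T_x K = 0` but `dim T_x K = 8`
      have hV0 : ∀ v : V, v = 0 :=
        RankTwo.eq_zero_of_free (F := ℂ) (by norm_num) (τ g') (τ γ') hcommτ ha5 hb5 hfree
      haveI : Subsingleton V := ⟨fun a b => by rw [hV0 a, hV0 b]⟩
      have : Module.finrank ℂ V = 0 := Module.finrank_zero_of_subsingleton
      omega
    · exact (Subgroup.zpowers_le).2 (MulAction.mem_stabilizer_iff.2 (Subtype.ext hx))
  -- orbit–stabiliser: `|Γ · x'| = 625 / 5 = 125 = |S|`, so the orbit is everything
  have hindex : (MulAction.stabilizer (Hyperkaehler.autFixingH2H3 K) x').index = 125 := by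
    have h := (MulAction.stabilizer (Hyperkaehler.autFixingH2H3 K) x').index_mul_card
    rw [hstab, Nat.card_zpowers, horder, hcard] at h
    rw [hstab]
    omega
  have horbit : (MulAction.orbit (Hyperkaehler.autFixingH2H3 K) x').ncard = 125 := by
    rw [← MulAction.index_stabilizer, hindex]
  have huniv : MulAction.orbit (Hyperkaehler.autFixingH2H3 K) x' = Set.univ :=
    Set.eq_of_subset_of_ncard_le (Set.subset_univ _) (by rw [Set.ncard_univ, hcardS, horbit])
      Set.finite_univ
  have hy' : y' ∈ MulAction.orbit (Hyperkaehler.autFixingH2H3 K) x' := by rw [huniv]; exact Set.mem_univ _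
  obtain ⟨γ, hγ⟩ := MulAction.mem_orbit_iff.1 hy'
  exact ⟨γ, by rw [← hsmul γ x', hγ]⟩

/-! ### Corollaries: (H3), the point count and the rung WITHOUT the (H2) hypothesis -/

/-- **(H3) from three printed statements** (`Γ ≅ (ℤ/5)⁴`, Oguiso's `125` reduced fixed points, the
tangent-dimension fact): (H2) is now derived.  CONDITIONAL; nothing is proved outright. -/
theorem kum4FixedFourfoldHasFixedPointAtKummer_of_tangentFixed'
    (hFV : FloccariVaresco2024_autFixingH2H3_equiv_kumType)
    (hOg : Oguiso2020_fixedPointScheme_translation_generalizedKummerFour)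
    (hT : GroupActions.Milne2017_fixedComponent_dim_eq_finrank_tangentFixed) :
    Kum4FixedFourfoldHasFixedPointAtKummer :=
  kum4FixedFourfoldHasFixedPointAtKummer_of_tangentFixed hFV
    (oguiso2020_translations_transitive_of_tangentFixed hFV hOg hT) hOg hT

/-- **The point count (item stmt-Ventures-19504) from the same three printed statements.**  CONDITIONAL. -/
theorem kum4FixedPointCountAtKummer_of_tangentFixed'
    (hFV : FloccariVaresco2024_autFixingH2H3_equiv_kumType)
    (hOg : Oguiso2020_fixedPointScheme_translation_generalizedKummerFour)
    (hT : GroupActions.Milne2017_fixedComponent_dim_eq_finrank_tangentFixed) :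
    Kum4FixedPointCountAtKummer :=
  kum4FixedPointCountAtKummer_of_tangentFixed hFV
    (oguiso2020_translations_transitive_of_tangentFixed hFV hOg hT) hOg hT

/-- **H3 for `Kum⁴`-type and its powers from REFEREED PRINT + the transport synthesis (T) + L1** — the
rung from sixteen printed statements (fifteen refereed: the eleven of `hc_kum4Type_of_L1_of_meetsTranslates`,
`Γ ≅ (ℤ/5)⁴`, `|Γ| = 625`, Oguiso's split fixed points, the tangent-dimension fact; one print-synthesis:
the cohomological transport (T)) and p1's cell lemma L1.  The atom (H3) AND the transitivity (H2) are
DISCHARGED in the kernel.  CONDITIONAL on all hypotheses; nothing here says `HC_Kum4Type` or the Hodge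
conjecture is proved outright. -/
theorem hc_kum4Type_of_L1_of_tangentFixed'
    (hOGV : OGradyVoisin2022_thirdJacobian_kugaSatake_kummerType)
    (hFF : HodgeTheory.FloccariFu2026_hodgeClasses_algebraic_powers_discOneWeilFourfold)
    (hFo : Foster2024_lefschetzStandard_kummerType_prime)
    (hAn : HodgeTheory.Andre1996_dualLefschetz_mem_adjoin_lefschetzInvolution)
    (hA1 : HodgeTheory.Hirzebruch1969_gSignature_involution_halfDimFixedLocus)
    (hA2 : Floccari2026_fixedFourfold_kum4Type)
    (hHIR : HodgeTheory.Voisin2002_hodgeIndex_hodgeRiemann_middle)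
    (hGS : GoettscheSoergel1993_chiY_kum4Type)
    (hGK : GreenKimLazaRobles2022_llvTrivial_isOfHodgeType_kumType)
    (hF : Foster2024_translationAction_kum4Type)
    (hcardF : Floccari2026_card_autFixingH2H3_kum4Type)
    (hFu : HodgeTheory.Fulton1998_cupPairing_transversalPoint)
    (hFV : FloccariVaresco2024_autFixingH2H3_equiv_kumType)
    (hTr : HassettTschinkel2013_Floccari2026_fixedFourfoldClass_transport_kum4Type)
    (hOg : Oguiso2020_fixedPointScheme_translation_generalizedKummerFour)
    (hTan : GroupActions.Milne2017_fixedComponent_dim_eq_finrank_tangentFixed)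
    (hL1 : LefschetzGenerationKum4) :
    Summit.Ventures.HodgeKum4.HC_Kum4Type ∧ Summit.Ventures.HodgeKum4.HC_Kum4TypePowers :=
  hc_kum4Type_of_L1_of_tangentFixed hOGV hFF hFo hAn hA1 hA2 hHIR hGS hGK hF hcardF hFu hFV hTr hOg
    (oguiso2020_translations_transitive_of_tangentFixed hFV hOg hTan) hTan hL1

end Summit.Ventures.HodgeKum4

end
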